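import Literature.Probability.LatticeModels.UrsellFourCurrents
import Literature.Probability.LatticeModels.RandomCurrentsProofs
import Mathlib.Algebra.BigOperators.Ring.Nat
import HarnessLib

/-!
# Ursell's four-point function as a double-current connection probability: proof

Sibling proof file of `Literature.Probability.LatticeModels.UrsellFourCurrents`. It **discharges**
the named fact `ursellFour_eq_doubleCurrent` (Aizenman 1982; Duminil-Copin 2016, §4.3, eq. (24):
"the switching lemma enables us to rewrite `U₄(x₁,x₂,x₃,x₄)` as
`U₄(x₁,x₂,x₃,x₄) = -2⟨σ_{x₁}σ_{x₃}⟩⟨σ_{x₂}σ_{x₄}⟩ P^{x₁x₃} ⊗ P^{x₂x₄}[x₁ ⟷ x₂,x₃,x₄ in n₁+n₂]`";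
Aizenman–Duminil-Copin 2021, eq. (3.11): "Combining (3.10) for the different values of the product
of spin-spin correlations leads to (3.11)"), in the tree's finite-graph, free-boundary, zero-field
spelling: for `β ≥ 0` and vertices `x y z t` of the finite graph `G`,

`U₄(x,y,z,t) = -2 ⟨σ_xσ_y⟩⟨σ_zσ_t⟩ · P^{{x}∆{y}} ⊗ P^{{z}∆{t}}[x ⟷ z in n₁ + n₂]`

(`ursellFour_eq_doubleCurrent_holds`), from the random-current representation
`⟨σ_A⟩ = Z_A/Z_∅` (`isingCorr_free_eq_currentSum_div_holds`) and the switching lemma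
(`currentSum_switching_holds`, Duminil-Copin 2016, Lemma 2.2) of `RandomCurrentsProofs`.

It also **discharges** the other named fact of that file, the source-insertion identity
`isingCorr_mul_eq_doubleCurrent_subcurrent` (Aizenman–Duminil-Copin 2021, eq. (3.7):
`⟨σ_A⟩⟨σ_B⟩ = ⟨σ_Aσ_B⟩ · P^{A∆B,∅}[𝐧₁ + 𝐧₂ ∈ 𝓕_B]`, `isingCorr_mul_eq_doubleCurrent_subcurrent_holds`),
by proving the switching lemma in its general **`𝓕_B` form** (Aizenman–Duminil-Copin 2021,
Lemma 3.3: arbitrary source set `B` of the second current, indicator of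
`𝓕_B = {𝐧 | ∃ 𝐦 ≤ 𝐧, ∂𝐦 = B}`; `currentSum_switching_subcurrent`, every real `β`, bounded `F`) with
the labelled-sub-current machinery of `RandomCurrentsProofs` (`Current.switching_comb_subcurrent`),
and checks that `𝓕_{{x}∆{y}} = {x ⟷ y}` (`subcurrentEvent_pair`), so that the `𝓕_B` form contains
the two-source form. See the section *The switching lemma in the `𝓕_B` form* below.

## Proof

Write `Z_A = currentSum G β A`, `S = {x} ∆ {y} ∆ {z} ∆ {t}` and, for pairs `(n₁,n₂)` with
`∂n₁ = S`, `∂n₂ = ∅`, `𝟙_{uv} = 𝟙[u ⟷ v in n₁ + n₂]`. Multiplying `U₄` by `Z_∅²`: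

* `Z_∅² ⟨σ_xσ_yσ_zσ_t⟩ = Z_S Z_∅ = ∑_{∂n₁ = S, ∂n₂ = ∅} w(n₁)w(n₂)` (`σ_xσ_yσ_zσ_t = σ_S`,
  `spinMonomial_four_eq_spinProduct`);
* by the switching lemma with `F = 1` (`currentSum_mul_currentSum_eq_tsum`),
  `Z_∅² ⟨σ_xσ_y⟩⟨σ_zσ_t⟩ = Z_{{x}∆{y}} Z_{{z}∆{t}} = ∑_{∂n₁ = S, ∂n₂ = ∅} w w 𝟙_{zt}`, and likewise
  `Z_{{x}∆{z}} Z_{{y}∆{t}} = ∑ w w 𝟙_{yt}`, `Z_{{x}∆{t}} Z_{{y}∆{z}} = ∑ w w 𝟙_{yz}`;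
* by the switching lemma with `F = 𝟙[x ⟷ z]`,
  `Z_∅² ⟨σ_xσ_y⟩⟨σ_zσ_t⟩ P^{{x}∆{y},{z}∆{t}}[x ⟷ z] = ∑_{∂n₁={x}∆{y}, ∂n₂={z}∆{t}} w w 𝟙[x ⟷ z]
   = ∑_{∂n₁ = S, ∂n₂ = ∅} w w 𝟙_{xz} 𝟙_{zt}` (`doubleCurrentMeasure_real_mul'`, valid without any
  non-degeneracy hypothesis since both sides vanish when `Z_{{x}∆{y}} Z_{{z}∆{t}} = 0`).

Hence (24) is the statement `∑_{∂n₁ = S, ∂n₂ = ∅} w w (1 - 𝟙_{zt} - 𝟙_{yt} - 𝟙_{yz} + 2 𝟙_{xz}𝟙_{zt})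
= 0` (`tsum_pairWeight_ursell_bracket`), and the bracket vanishes **pointwise**
(`Current.ursell_indicator_identity`): by the handshake identity on a cluster of the trace of
`n = n₁ + n₂` (`Current.even_card_sources_filter_reachable`: every traced edge meets a cluster in
`0` or `2` vertices, so a cluster contains an even number of sources), every cluster contains an
even number of the points `x, y, z, t` counted with multiplicity (`Current.even_reachable_count`,
`∂n = S`), i.e. the partition of `{x, y, z, t}` induced by the clusters is one of `xy|zt`,
`xz|yt`, `xt|yz`, `xyzt`, on each of which the bracket is `1-1-0-0+0`, `1-0-1-0+0`, `1-0-0-1+0`,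
`1-1-1-1+2` respectively. This is Aizenman's argument (Aizenman 1982, Prop. 5.1; cf. ADC2021,
(3.7)–(3.11)); coincident points need no separate treatment.

## Mathlib status and references

No random currents in Mathlib. Anchors: `Finset.even_sum_iff_even_card_odd`,
`Finset.filter_singleton`, `HasSum.unique`, `Summable.tsum_le_tsum`, `Matrix.cons_val` (simproc),
`Fin.prod_univ_four`, `ac_rfl` for `∆`; tree (`RandomCurrents(Proofs).lean`):
`currentSum_switching_holds`, `hasSum_pairWeight_holds`, `summable_pairWeight_mul`,
`doubleCurrentMeasure_real_mul`, `isingCorr_free_eq_currentSum_div_holds`,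
`isingTwoPoint_free_eq_currentSum_div_holds`, `currentSum_empty_pos'`, `Current.card_symmDiff_add`.
Sources: H. Duminil-Copin, *Random currents expansion of the Ising model*, arXiv:1607.06933, §4.3
eq. (24) and Lemma 2.2 [`DuminilCopin2016`]; M. Aizenman, H. Duminil-Copin, Ann. of Math. 194
(2021), arXiv:1912.07973, §3.1 (Def. 3.2, Lemma 3.3) and §3.2, (3.7)–(3.11)
[`AizenmanDuminilCopinAnnals2021`]; M. Aizenman, Comm. Math. Phys. 86 (1982), Prop. 5.1
[`Aizenman1982`, not held].
-/

noncomputable section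

open MeasureTheory Finset
open scoped symmDiff

namespace Literature.Probability.LatticeModels

variable {V : Type*} [Fintype V] [DecidableEq V] {G : SimpleGraph V} [DecidableRel G.Adj]

/-! ### Spin bookkeeping: `σ_xσ_yσ_zσ_t = σ_S` -/

omit [Fintype V] in
/-- `σ_{{u} ∆ A} = σ_u σ_A` (because `σ_u² = 1`; cf. `spinAt_mul_spinProduct` of
`ModifiedSimonInequality.lean`, whose import chain is not wanted here). [folklore] -/
theorem spinProduct_singleton_symmDiff (u : V) (A : Finset V) (σ : SpinConfig V) :
    spinProduct ({u} ∆ A) σ = spinAt u σ * spinProduct A σ := by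
  by_cases hu : u ∈ A
  · have h1 : ({u} : Finset V) ∆ A = A.erase u := by
      ext w; simp only [Finset.mem_symmDiff, Finset.mem_singleton, Finset.mem_erase]; grind
    rw [h1, spinProduct, spinProduct, ← Finset.mul_prod_erase A _ hu, ← mul_assoc, spinAt_mul_self,
      one_mul]
  · have h1 : ({u} : Finset V) ∆ A = insert u A := by
      ext w; simp only [Finset.mem_symmDiff, Finset.mem_singleton, Finset.mem_insert]; grind
    rw [h1, spinProduct, spinProduct, Finset.prod_insert hu]

omit [Fintype V] in
/-- `σ_xσ_yσ_zσ_t = σ_S` with `S = {x} ∆ ({y} ∆ ({z} ∆ {t}))` (repetitions allowed: `σ_u² = 1`;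
ADC2021, (3.7): "`σ_Aσ_B = σ_{A∆B}`"). [folklore] -/
theorem spinMonomial_four_eq_spinProduct (x y z t : V) :
    spinMonomial ![x, y, z, t] = spinProduct ({x} ∆ ({y} ∆ ({z} ∆ {t}))) := by
  funext σ
  have ht : spinProduct {t} σ = spinAt t σ := by simp [spinProduct]
  rw [spinProduct_singleton_symmDiff, spinProduct_singleton_symmDiff, spinProduct_singleton_symmDiff,
    ht]
  simp [spinMonomial, Fin.prod_univ_four, mul_assoc]

variable (G) in
/-- Random-current representation of the four-point function:
`⟨σ_xσ_yσ_zσ_t⟩^∅_{G;β,0} = Z_{{x}∆{y}∆{z}∆{t}} / Z_∅` (Duminil-Copin 2016, §2.1, the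
random-current representation `⟨σ_A⟩ = Z_A/Z_∅` with `σ_xσ_yσ_zσ_t = σ_A`).
[cite: DuminilCopin2016, §2.1] -/
theorem isingExpect_spinMonomial_four_eq (β : ℝ) (x y z t : V) :
    isingExpect G univ β 0 .free (spinMonomial ![x, y, z, t]) =
      currentSum G β ({x} ∆ ({y} ∆ ({z} ∆ {t}))) / currentSum G β ∅ := by
  rw [spinMonomial_four_eq_spinProduct]
  exact isingCorr_free_eq_currentSum_div_holds G β _

/-! ### Cluster parity and the pointwise identity -/

namespace Current

open Classical in
/-- **Handshake on a cluster.** In the trace of a current `n`, the cluster of any vertex `v`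
contains an even number of sources of `n`: every traced edge meets the cluster in `0` or `2`
vertices, so `∑_{u ↔ v} deg_n(u)` is even (Duminil-Copin 2016, §2.2, the fact behind "a current
with sources `{x,y}` contains a path from `x` to `y`"). [cite: DuminilCopin2016, §2.2] -/
theorem even_card_sources_filter_reachable (n : Current G) (v : V) :
    Even #(n.sources.filter fun u => (Percolation.openGraph n.traced).Reachable v u) := by
  set C : Finset V := univ.filter fun u => (Percolation.openGraph n.traced).Reachable v u with hC_def
  have hC : ∀ u, u ∈ C ↔ (Percolation.openGraph n.traced).Reachable v u := fun u => by simp [hC_def]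
  have hfilter : n.sources.filter (fun u => (Percolation.openGraph n.traced).Reachable v u) =
      C.filter (fun u => Odd (n.degree u)) := by
    ext u
    simp only [Finset.mem_filter, mem_sources_iff, hC]
    tauto
  rw [hfilter, ← Finset.even_sum_iff_even_card_odd]
  have hsum : ∑ u ∈ C, n.degree u =
      ∑ e : G.edgeFinset, n e * #(C.filter fun u => u ∈ (e : Sym2 V)) := by
    unfold degree
    rw [Finset.sum_comm]
    refine Finset.sum_congr rfl fun e _ => ?_
    rw [← Finset.sum_filter, Finset.sum_const, smul_eq_mul, mul_comm]
  rw [hsum]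
  refine Finset.even_sum _ fun e _ => ?_
  rcases Nat.eq_zero_or_pos (n e) with h0 | hpos
  · rw [h0, zero_mul]; exact Even.zero
  · refine Nat.even_mul.2 (Or.inr ?_)
    obtain ⟨e, he⟩ := e
    induction e using Sym2.ind with
    | _ a b =>
      have hab : a ≠ b := G.ne_of_adj (SimpleGraph.mem_edgeFinset.1 he)
      have hadj : (Percolation.openGraph n.traced).Adj a b := by
        rw [Percolation.openGraph_adj]
        exact ⟨⟨he, hpos⟩, hab⟩
      have hiff : a ∈ C ↔ b ∈ C := by
        rw [hC, hC]
        exact ⟨fun h => h.trans hadj.reachable, fun h => h.trans hadj.symm.reachable⟩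
      have hfil : C.filter (fun u => u ∈ (s(a, b) : Sym2 V)) =
          ({a, b} : Finset V).filter (· ∈ C) := by
        ext u
        simp only [Finset.mem_filter, Sym2.mem_iff, Finset.mem_insert, Finset.mem_singleton]
        tauto
      change Even #(C.filter fun u => u ∈ (s(a, b) : Sym2 V))
      rw [hfil, Finset.filter_insert, Finset.filter_singleton]
      by_cases ha : a ∈ C
      · have hb : b ∈ C := hiff.1 ha
        rw [if_pos ha, if_pos hb, Finset.card_insert_of_notMem (by simpa using hab)]
        simp
      · have hb : b ∉ C := fun hb => ha (hiff.2 hb)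
        rw [if_neg ha, if_neg hb]
        simp

omit [Fintype V] in
/-- Parity is additive under symmetric difference:
`#((A ∆ B).filter p) ≡ #(A.filter p) + #(B.filter p) (mod 2)`. [folklore] -/
theorem card_filter_symmDiff_mod_two (A B : Finset V) (p : V → Prop) [DecidablePred p] :
    #((A ∆ B).filter p) % 2 = (#(A.filter p) + #(B.filter p)) % 2 := by
  have h1 : (A ∆ B).filter p = (A.filter p) ∆ (B.filter p) := by
    ext u
    simp only [Finset.mem_filter, Finset.mem_symmDiff]
    tauto
  have h2 := card_symmDiff_add (A.filter p) (B.filter p)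
  rw [h1]
  omega

open Classical in
/-- For a current whose source set is `{x} ∆ ({y} ∆ ({z} ∆ {t}))`, every cluster of its trace
contains an even number of the points `x, y, z, t`, counted with multiplicity (handshake
`even_card_sources_filter_reachable` and additivity of parities). [folklore] -/
theorem even_reachable_count {n : Current G} {x y z t : V}
    (hn : n.sources = {x} ∆ ({y} ∆ ({z} ∆ {t}))) (v : V) :
    Even ((if (Percolation.openGraph n.traced).Reachable v x then 1 else 0) +
      (if (Percolation.openGraph n.traced).Reachable v y then 1 else 0) +
      (if (Percolation.openGraph n.traced).Reachable v z then 1 else 0) +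
      (if (Percolation.openGraph n.traced).Reachable v t then 1 else 0)) := by
  set p : V → Prop := fun u => (Percolation.openGraph n.traced).Reachable v u with hp
  have h := even_card_sources_filter_reachable n v
  rw [hn] at h
  have hs : ∀ u : V, #(({u} : Finset V).filter p) = if p u then 1 else 0 := fun u => by
    rw [Finset.filter_singleton]
    split_ifs <;> simp
  rw [Nat.even_iff] at h ⊢
  rw [card_filter_symmDiff_mod_two, Nat.add_mod, card_filter_symmDiff_mod_two {y},
    Nat.add_mod (#(_)), card_filter_symmDiff_mod_two {z}, hs, hs, hs, hs] at h
  simp only [hp] at h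
  omega

open Classical in
/-- **The pointwise identity behind (24).** If `∂n = {x} ∆ {y} ∆ {z} ∆ {t}` then, with
`𝟙_{uv} = 𝟙[u ⟷ v in the trace of n]`,
`1 - 𝟙_{zt} - 𝟙_{yt} - 𝟙_{yz} + 2·𝟙_{xz}𝟙_{zt} = 0`: the partition of `x, y, z, t` induced by the
clusters has even blocks (`even_reachable_count`), i.e. it is `xy|zt`, `xz|yt`, `xt|yz` or `xyzt`
(Aizenman's argument; Duminil-Copin 2016, §4.3). [cite: DuminilCopin2016, §4.3, eq. (24)] -/
theorem ursell_indicator_identity {n : Current G} {x y z t : V}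
    (hn : n.sources = {x} ∆ ({y} ∆ ({z} ∆ {t}))) :
    (1 : ℝ) - (if (Percolation.openGraph n.traced).Reachable z t then 1 else 0)
      - (if (Percolation.openGraph n.traced).Reachable y t then 1 else 0)
      - (if (Percolation.openGraph n.traced).Reachable y z then 1 else 0)
      + 2 * (if (Percolation.openGraph n.traced).Reachable x z then 1 else 0)
          * (if (Percolation.openGraph n.traced).Reachable z t then 1 else 0) = 0 := by
  have hx := even_reachable_count hn x
  have hy := even_reachable_count hn y
  have hz := even_reachable_count hn z
  set R := (Percolation.openGraph n.traced).Reachable with hR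
  have sy : ∀ {u v : V}, R u v → R v u := fun h => h.symm
  have tr : ∀ {u v w : V}, R u v → R v w → R u w := fun h1 h2 => h1.trans h2
  rw [if_pos (SimpleGraph.Reachable.refl x : R x x), Nat.even_iff] at hx
  rw [if_pos (SimpleGraph.Reachable.refl y : R y y), Nat.even_iff] at hy
  rw [if_pos (SimpleGraph.Reachable.refl z : R z z), Nat.even_iff] at hz
  by_cases b : R x z
  · by_cases g : R z t
    · have c : R x t := tr b g
      have a : R x y := by
        by_contra a
        rw [if_neg a, if_pos b, if_pos c] at hx
        omega
      have d : R y z := tr (sy a) b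
      have e : R y t := tr (sy a) c
      rw [if_pos g, if_pos e, if_pos d, if_pos b]
      norm_num
    · have c : ¬R x t := fun c => g (tr (sy b) c)
      have a : ¬R x y := by
        intro a
        rw [if_pos a, if_pos b, if_neg c] at hx
        omega
      have d : ¬R y z := fun d => a (tr b (sy d))
      have e : R y t := by
        by_contra e
        rw [if_neg (fun h => a (sy h)), if_neg d, if_neg e] at hy
        omega
      rw [if_neg g, if_pos e, if_neg d, if_pos b]
      norm_num
  · by_cases a : R x y
    · have d : ¬R y z := fun d => b (tr a d)
      have c : ¬R x t := by
        intro c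
        rw [if_pos a, if_neg b, if_pos c] at hx
        omega
      have e : ¬R y t := fun e => c (tr a e)
      have g : R z t := by
        by_contra g
        rw [if_neg (fun h => b (sy h)), if_neg (fun h => d (sy h)), if_neg g] at hz
        omega
      rw [if_pos g, if_neg e, if_neg d, if_neg b]
      norm_num
    · have c : R x t := by
        by_contra c
        rw [if_neg a, if_neg b, if_neg c] at hx
        omega
      have g : ¬R z t := fun g => b (tr c (sy g))
      have e : ¬R y t := fun e => a (tr c (sy e))
      have d : R y z := by
        by_contra d
        rw [if_neg (fun h => a (sy h)), if_neg d, if_neg e] at hy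
        omega
      rw [if_neg g, if_neg e, if_pos d, if_neg b]
      norm_num

end Current

/-- The pointwise identity for pairs of currents, in the spelling of `tracedConn`:
if `∂(n₁ + n₂) = {x} ∆ {y} ∆ {z} ∆ {t}` then
`1 - 𝟙[z⟷t] - 𝟙[y⟷t] - 𝟙[y⟷z] + 2·𝟙[x⟷z]𝟙[z⟷t] = 0`. [cite: DuminilCopin2016, §4.3, eq. (24)] -/
theorem ursell_tracedConn_indicator_identity {p : Current G × Current G} {x y z t : V}
    (hp : (p.1 + p.2).sources = {x} ∆ ({y} ∆ ({z} ∆ {t}))) :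
    (1 : ℝ) - (tracedConn G z t).indicator 1 p - (tracedConn G y t).indicator 1 p
      - (tracedConn G y z).indicator 1 p
      + 2 * (tracedConn G x z).indicator 1 p * (tracedConn G z t).indicator 1 p = 0 := by
  classical
  simp only [Set.indicator_apply, mem_tracedConn_iff, Pi.one_apply]
  convert Current.ursell_indicator_identity hp

/-! ### Sums over pairs of currents -/

variable (G)

/-- The switching lemma with `F = 1`, as an identity of series (Duminil-Copin 2016, Lemma 2.2):
`Z_A · Z_{{u}∆{v}} = ∑_{∂n₁ = A ∆ {u} ∆ {v}, ∂n₂ = ∅} w(n₁) w(n₂) 𝟙[u ⟷ v in n₁ + n₂]`, for every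
real `β`. [cite: DuminilCopin2016, Lemma 2.2] -/
theorem currentSum_mul_currentSum_eq_tsum (β : ℝ) (A : Finset V) (u v : V) :
    currentSum G β A * currentSum G β ({u} ∆ {v}) =
      ∑' p : Current G × Current G,
        pairWeight G β (A ∆ ({u} ∆ {v})) ∅ p * (tracedConn G u v).indicator 1 p := by
  have hsw := currentSum_switching_holds G β A u v (fun _ => 1) ⟨1, fun n => by simp⟩
  simp only [mul_one] at hsw
  rw [(hasSum_pairWeight_holds G β A ({u} ∆ {v})).tsum_eq] at hsw
  exact hsw

/-- `P^{A,B}(E) · Z_A Z_B = ∑_p w_{A,B}(p) 𝟙_E(p)` for `β ≥ 0`, **without** non-degeneracy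
hypothesis: if `Z_A Z_B = 0` the measure is the junk `0` and every pair weight vanishes
(`0 ≤ ∑ w 𝟙_E ≤ ∑ w = Z_A Z_B`). [cite: DuminilCopin2016, §2.2] -/
theorem doubleCurrentMeasure_real_mul' {β : ℝ} (hβ : 0 ≤ β) (A B : Finset V)
    {E : Set (Current G × Current G)} (hE : MeasurableSet E) :
    (doubleCurrentMeasure G β A B).real E * (currentSum G β A * currentSum G β B) =
      ∑' p, pairWeight G β A B p * E.indicator 1 p := by
  classical
  by_cases hZ : currentSum G β A * currentSum G β B = 0
  · rw [hZ, mul_zero]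
    have h1 : ∀ p : Current G × Current G, ‖E.indicator (1 : Current G × Current G → ℝ) p‖ ≤ 1 :=
      fun p => by rw [Set.indicator_apply]; split_ifs <;> simp
    have hle : ∀ p, pairWeight G β A B p * E.indicator 1 p ≤ pairWeight G β A B p := fun p => by
      refine mul_le_of_le_one_right (pairWeight_nonneg G hβ A B p) ?_
      rw [Set.indicator_apply]; split_ifs <;> simp
    have hge : ∀ p, 0 ≤ pairWeight G β A B p * E.indicator 1 p := fun p =>
      mul_nonneg (pairWeight_nonneg G hβ A B p) (by rw [Set.indicator_apply]; split_ifs <;> simp)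
    have h0 : ∑' p, pairWeight G β A B p = 0 := by
      rw [(hasSum_pairWeight_holds G β A B).tsum_eq, hZ]
    refine le_antisymm ?_ ((Summable.tsum_le_tsum hle (summable_pairWeight_mul G β A B h1)
      (hasSum_pairWeight_holds G β A B).summable).trans_eq h0)
    exact tsum_nonneg hge
  · exact doubleCurrentMeasure_real_mul G β hβ A B hE hZ

/-- **The series identity behind (24)**: with `S = {x} ∆ {y} ∆ {z} ∆ {t}` and the sums running
over pairs `∂n₁ = S, ∂n₂ = ∅`,
`∑ w w - ∑ w w 𝟙_{zt} - ∑ w w 𝟙_{yt} - ∑ w w 𝟙_{yz} + 2 ∑ w w 𝟙_{xz}𝟙_{zt} = 0`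
(the summand vanishes pointwise, `ursell_tracedConn_indicator_identity`).
[cite: DuminilCopin2016, §4.3, eq. (24)] -/
theorem tsum_pairWeight_ursell_bracket (β : ℝ) (x y z t : V) :
    (∑' p, pairWeight G β ({x} ∆ ({y} ∆ ({z} ∆ {t}))) ∅ p)
      - (∑' p, pairWeight G β ({x} ∆ ({y} ∆ ({z} ∆ {t}))) ∅ p * (tracedConn G z t).indicator 1 p)
      - (∑' p, pairWeight G β ({x} ∆ ({y} ∆ ({z} ∆ {t}))) ∅ p * (tracedConn G y t).indicator 1 p)
      - (∑' p, pairWeight G β ({x} ∆ ({y} ∆ ({z} ∆ {t}))) ∅ p * (tracedConn G y z).indicator 1 p)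
      + 2 * (∑' p, pairWeight G β ({x} ∆ ({y} ∆ ({z} ∆ {t}))) ∅ p *
          ((tracedConn G x z).indicator 1 p * (tracedConn G z t).indicator 1 p)) = 0 := by
  classical
  set S : Finset V := {x} ∆ ({y} ∆ ({z} ∆ {t})) with hS
  have hb : ∀ (u v : V) (p : Current G × Current G),
      ‖(tracedConn G u v).indicator (1 : Current G × Current G → ℝ) p‖ ≤ 1 := fun u v p => by
    rw [Set.indicator_apply]; split_ifs <;> simp
  have hW := hasSum_pairWeight_holds G β S ∅
  have hW' : HasSum (pairWeight G β S ∅) (∑' p, pairWeight G β S ∅ p) := hW.summable.hasSum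
  have h1 := (summable_pairWeight_mul G β S ∅ (hb z t)).hasSum
  have h2 := (summable_pairWeight_mul G β S ∅ (hb y t)).hasSum
  have h3 := (summable_pairWeight_mul G β S ∅ (hb y z)).hasSum
  have hq := (summable_pairWeight_mul G β S ∅
    (Φ := fun p => (tracedConn G x z).indicator 1 p * (tracedConn G z t).indicator 1 p) (C := 1)
    (fun p => by rw [norm_mul]; exact mul_le_one₀ (hb x z p) (norm_nonneg _) (hb z t p))).hasSum
  have h := (((hW'.sub h1).sub h2).sub h3).add (hq.mul_left 2)
  refine h.unique ?_
  have hzero : (fun p : Current G × Current G =>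
      pairWeight G β S ∅ p - pairWeight G β S ∅ p * (tracedConn G z t).indicator 1 p
        - pairWeight G β S ∅ p * (tracedConn G y t).indicator 1 p
        - pairWeight G β S ∅ p * (tracedConn G y z).indicator 1 p
        + 2 * (pairWeight G β S ∅ p *
          ((tracedConn G x z).indicator 1 p * (tracedConn G z t).indicator 1 p))) = fun _ => 0 := by
    funext p
    by_cases hp : p.1.sources = S ∧ p.2.sources = ∅
    · have hsrc : (p.1 + p.2).sources = {x} ∆ ({y} ∆ ({z} ∆ {t})) := by
        rw [Current.sources_add, hp.1, hp.2, hS]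
        simp
      have key := ursell_tracedConn_indicator_identity hsrc
      calc _ = pairWeight G β S ∅ p * ((1 : ℝ) - (tracedConn G z t).indicator 1 p
            - (tracedConn G y t).indicator 1 p - (tracedConn G y z).indicator 1 p
            + 2 * (tracedConn G x z).indicator 1 p * (tracedConn G z t).indicator 1 p) := by ring
        _ = 0 := by rw [key, mul_zero]
    · have h0 : pairWeight G β S ∅ p = 0 := by
        unfold pairWeight
        rw [if_neg hp]
      simp [h0]
  rw [hzero]
  exact hasSum_zero

/-- Algebraic assembly of (24) from the five series identities. [folklore] -/
theorem ursell_assembly {Z cS cxy czt cxz cyt cxt cyz P a b₁ b₂ b₃ q : ℝ} (hZ : Z ≠ 0)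
    (p0 : cS * Z = a) (p1 : cxy * czt = b₁) (p2 : cxz * cyt = b₂) (p3 : cxt * cyz = b₃)
    (pq : cxy * czt * P = q) (key : a - b₁ - b₂ - b₃ + 2 * q = 0) :
    cS / Z - cxy / Z * (czt / Z) - cxz / Z * (cyt / Z) - cxt / Z * (cyz / Z) =
      -2 * (cxy / Z) * (czt / Z) * P := by
  have h : cS / Z - cxy / Z * (czt / Z) - cxz / Z * (cyt / Z) - cxt / Z * (cyz / Z)
      + 2 * (cxy / Z) * (czt / Z) * P =
      (cS * Z - cxy * czt - cxz * cyt - cxt * cyz + 2 * (cxy * czt * P)) / Z ^ 2 := by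
    field_simp
  rw [p0, pq, p1, p2, p3, key, zero_div] at h
  linarith

/-! ### The discharge -/

/-- **Discharge of `ursellFour_eq_doubleCurrent`** — Ursell's four-point function via random
currents (Aizenman 1982, Prop. 5.1; Duminil-Copin 2016, §4.3, eq. (24); Aizenman–Duminil-Copin
2021, eq. (3.11)): for the nearest-neighbour Ising model on the finite graph `G` with free
boundary condition, zero field and `β ≥ 0`, and all vertices `x y z t`,
`U₄(x,y,z,t) = -2 ⟨σ_xσ_y⟩⟨σ_zσ_t⟩ · P^{{x}∆{y}} ⊗ P^{{z}∆{t}}[x ⟷ z in n₁ + n₂]`.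
[cite: DuminilCopin2016, §4.3, eq. (24)] [cite: AizenmanDuminilCopinAnnals2021, eq. (3.11)] -/
theorem ursellFour_eq_doubleCurrent_holds : ursellFour_eq_doubleCurrent G := by
  classical
  intro β hβ x y z t
  have hZ : currentSum G β ∅ ≠ 0 := (currentSum_empty_pos' G β).ne'
  have h2 := isingTwoPoint_free_eq_currentSum_div_holds G β
  -- the five series identities
  have p0 : currentSum G β ({x} ∆ ({y} ∆ ({z} ∆ {t}))) * currentSum G β ∅ =
      ∑' p, pairWeight G β ({x} ∆ ({y} ∆ ({z} ∆ {t}))) ∅ p := by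
    rw [(hasSum_pairWeight_holds G β _ ∅).tsum_eq]
  have p1 := currentSum_mul_currentSum_eq_tsum G β ({x} ∆ {y}) z t
  rw [symmDiff_assoc] at p1
  have p2 := currentSum_mul_currentSum_eq_tsum G β ({x} ∆ {z}) y t
  have e2 : (({x} : Finset V) ∆ {z}) ∆ ({y} ∆ {t}) = {x} ∆ ({y} ∆ ({z} ∆ {t})) := by ac_rfl
  rw [e2] at p2
  have p3 := currentSum_mul_currentSum_eq_tsum G β ({x} ∆ {t}) y z
  have e3 : (({x} : Finset V) ∆ {t}) ∆ ({y} ∆ {z}) = {x} ∆ ({y} ∆ ({z} ∆ {t})) := by ac_rfl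
  rw [e3] at p3
  have pq : currentSum G β ({x} ∆ {y}) * currentSum G β ({z} ∆ {t}) *
      (doubleCurrentMeasure G β ({x} ∆ {y}) ({z} ∆ {t})).real (tracedConn G x z) =
      ∑' p, pairWeight G β ({x} ∆ ({y} ∆ ({z} ∆ {t}))) ∅ p *
        ((tracedConn G x z).indicator 1 p * (tracedConn G z t).indicator 1 p) := by
    rw [mul_comm, doubleCurrentMeasure_real_mul' G hβ _ _ (measurableSet_tracedConn G x z)]
    obtain ⟨F, hF⟩ : ∃ F : Current G → ℝ, ∀ m, F m =
        {m : Current G | (Percolation.openGraph m.traced).Reachable x z}.indicator 1 m :=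
      ⟨_, fun _ => rfl⟩
    have hFp : ∀ p : Current G × Current G, F (p.1 + p.2) = (tracedConn G x z).indicator 1 p :=
      fun p => by
        simp only [hF, Set.indicator_apply, Set.mem_setOf_eq, mem_tracedConn_iff, Pi.one_apply]
    have hsw := currentSum_switching_holds G β ({x} ∆ {y}) z t F
      ⟨1, fun m => by rw [hF, Set.indicator_apply]; split_ifs <;> simp⟩
    simp only [hFp] at hsw
    rw [hsw, symmDiff_assoc]
    exact tsum_congr fun p => by ring
  have key := tsum_pairWeight_ursell_bracket G β x y z t
  -- assemble
  simp only [connectedFour, nPoint_isingMeasure, twoPoint_isingMeasure, Matrix.cons_val]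
  rw [isingExpect_spinMonomial_four_eq, h2 x y, h2 z t, h2 x z, h2 y t, h2 x t, h2 y z]
  exact ursell_assembly hZ p0 p1 p2 p3 pq key


/-! ### The requested spelling `doubleCurrentU4Identity` (item `provefact … doubleCurrentU4Identity`)

`doubleCurrentU4Identity G` is by definition (`abbrev`) the fact `ursellFour_eq_doubleCurrent G`;
its discharge is therefore `ursellFour_eq_doubleCurrent_holds G`. We also record the identity in
the printed spelling of Aizenman–Duminil-Copin 2021, eq. (3.11) (pair sources `{x, y}`, `{z, t}`,
cluster-intersection event) as an unconditional theorem. -/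

/-- **Discharge of `doubleCurrentU4Identity`** — the double-current identity for Ursell's
four-point function (Aizenman 1982, Prop. 5.1; Duminil-Copin 2016, §4.3, eq. (24);
Aizenman–Duminil-Copin 2021, §3.2, eq. (3.11): "`U₄^β(x,y,z,t) = -2⟨σ_xσ_y⟩_β⟨σ_zσ_t⟩_β
P^{xy,zt}_β[C_{n₁+n₂}(x) ∩ C_{n₁+n₂}(z) ≠ ∅]`", obtained by "combining (3.10) for the different
values of the product of spin-spin correlations"): for the nearest-neighbour Ising model on the
finite graph `G` with free boundary condition, zero field and `β ≥ 0`, and all vertices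
`x y z t`, `U₄(x,y,z,t) = -2 ⟨σ_xσ_y⟩⟨σ_zσ_t⟩ · P^{{x}∆{y}} ⊗ P^{{z}∆{t}}[x ⟷ z in n₁ + n₂]`.
The proof is `ursellFour_eq_doubleCurrent_holds` (random-current representation, switching
lemma, cluster parity).
[cite: AizenmanDuminilCopinAnnals2021, eq. (3.11)] [cite: DuminilCopin2016, §4.3, eq. (24)] -/
theorem doubleCurrentU4Identity_holds : doubleCurrentU4Identity G :=
  ursellFour_eq_doubleCurrent_holds G

variable {G}

/-- Aizenman–Duminil-Copin 2021, eq. (3.11), in its printed spelling and now unconditional: for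
`β ≥ 0`, `x ≠ y` and `z ≠ t`,
`U₄(x,y,z,t) = -2 ⟨σ_xσ_y⟩⟨σ_zσ_t⟩ · P^{{x,y},{z,t}}[C_{n₁+n₂}(x) ∩ C_{n₁+n₂}(z) ≠ ∅]`
(finite graph, free boundary condition, zero field).
[cite: AizenmanDuminilCopinAnnals2021, eq. (3.11)] -/
theorem doubleCurrentU4Identity_eq_pair {β : ℝ} (hβ : 0 ≤ β) {x y z t : V} (hxy : x ≠ y)
    (hzt : z ≠ t) :
    connectedFour (isingMeasure G univ β 0 .free) spinAt ![x, y, z, t] =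
      -2 * isingTwoPoint G univ β 0 .free x y * isingTwoPoint G univ β 0 .free z t *
        (doubleCurrentMeasure G β {x, y} {z, t}).real (tracedClustersMeet G x z) :=
  ursellFour_eq_doubleCurrent.eq_pair (ursellFour_eq_doubleCurrent_holds G) hβ hxy hzt

/-- Lebowitz' inequality `U₄(x,y,z,t) ≤ 0` from the (now unconditional) random-current identity
(24), whose right-hand side is `≤ 0` once `⟨σ_xσ_y⟩, ⟨σ_zσ_t⟩ ≥ 0` (Griffiths I, fed as
hypotheses); Duminil-Copin 2016, §4.3 ("random currents were used to show that Ursell `2n`-point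
functions is positive if and only if `n` is odd"); cf. `Literature.Probability.LatticeModels.lebowitz`.
[cite: DuminilCopin2016, §4.3, eq. (24)] -/
theorem connectedFour_isingMeasure_free_nonpos {β : ℝ} (hβ : 0 ≤ β) (x y z t : V)
    (hxy : 0 ≤ isingTwoPoint G univ β 0 .free x y) (hzt : 0 ≤ isingTwoPoint G univ β 0 .free z t) :
    connectedFour (isingMeasure G univ β 0 .free) spinAt ![x, y, z, t] ≤ 0 :=
  ursellFour_eq_doubleCurrent.nonpos (ursellFour_eq_doubleCurrent_holds G) hβ x y z t hxy hzt

variable (G)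


/-! ## The switching lemma in the `𝓕_B` form and source insertion (ADC2021, Lemma 3.3 and (3.7))

Aizenman–Duminil-Copin 2021, Lemma 3.3, is the switching lemma with an **arbitrary** source set
`B` for the second current, the price being that the connection indicator `𝟙[x ⟷ y]` of the
two-source form (`currentSum_switching_holds`, `B = {x} ∆ {y}`) becomes the indicator of
`𝓕_B = {n | ∃ m ≤ n, ∂m = B}` (Def. 3.2 (iii); `subcurrentEvent`):

`∑_{∂n₁ = A, ∂n₂ = B} F(n₁+n₂) w(n₁)w(n₂) = ∑_{∂n₁ = A∆B, ∂n₂ = ∅} F(n₁+n₂) w(n₁)w(n₂) 𝟙[n₁+n₂ ∈ 𝓕_B]`.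

The proof is the one of `currentSum_switching_holds` (Duminil-Copin 2016, proof of Lemma 2.2),
and is in fact simpler: after the change of variables `(𝐦, 𝐧) = (𝐧₁+𝐧₂, 𝐧₁)` and
`w(𝐧)w(𝐦-𝐧) = w(𝐦)C(𝐦,𝐧)`, one needs for each `𝐦` with `∂𝐦 = A ∆ B` that the labelled
sub-currents `𝓝` of `𝐦` with `∂𝓝 = A` are equinumerous with those with `∂𝓝 = A ∆ B` when
`𝐦 ∈ 𝓕_B` — the involution `𝓝 ↦ 𝓝 ∆ 𝓚` for any labelling `𝓚` of a sub-current `𝐤 ≤ 𝐦` with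
`∂𝐤 = B` (`Current.exists_labelled_of_le`, `Current.card_filter_sources_eq_of_symmDiff`) — and
that there are none of the first kind when `𝐦 ∉ 𝓕_B` (for such an `𝓝`, `𝐦 - 𝓝 ≤ 𝐦` has sources
`∂𝐦 ∆ A = B`). With `F = 1` and the random-current representation `⟨σ_A⟩ = Z_A/Z_∅` this gives
(3.7), `⟨σ_A⟩⟨σ_B⟩ = ⟨σ_Aσ_B⟩ · P^{A∆B,∅}[n₁+n₂ ∈ 𝓕_B]`, discharging
`isingCorr_mul_eq_doubleCurrent_subcurrent`. -/

namespace Current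

omit [DecidableEq V] in
/-- Every sub-current `k ≤ m` has a labelling: a choice of `k_e` of the `m_e` copies of each edge.
[cite: DuminilCopin2016, Lemma 2.2 (proof)] -/
theorem exists_labelled_of_le {m k : Current G} (hk : k ≤ m) :
    ∃ K : (e : G.edgeFinset) → Finset (Fin (m e)), (fun e => (K e).card) = k := by
  have h : ∀ e : G.edgeFinset, ∃ T : Finset (Fin (m e)), T.card = k e := fun e => by
    obtain ⟨T, -, hT⟩ := Finset.exists_subset_card_eq (s := (univ : Finset (Fin (m e))))
      (n := k e) (by simpa using hk e)
    exact ⟨T, hT⟩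
  choose K hK using h
  exact ⟨K, funext hK⟩

omit [DecidableEq V] in
/-- `m - n ≤ m` for currents. [folklore] -/
theorem tsub_le_self' (m n : Current G) : m - n ≤ m := fun e => Nat.sub_le (m e) (n e)

open Classical in
/-- **The combinatorial switching identity, `𝓕_B` form** (Aizenman–Duminil-Copin 2021, Lemma 3.3;
Duminil-Copin 2016, proof of Lemma 2.2): for a current `𝐦` and sets `A`, `B`,
`∑_{𝐧 ≤ 𝐦, ∂𝐧 = A, ∂(𝐦-𝐧) = B} C(𝐦,𝐧) = 𝟙[∃ 𝐤 ≤ 𝐦, ∂𝐤 = B] ∑_{𝐧 ≤ 𝐦, ∂𝐧 = A ∆ B, ∂(𝐦-𝐧) = ∅} C(𝐦,𝐧)`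
(if `𝐦 ∈ 𝓕_B`, the involution `𝓝 ↦ 𝓝 ∆ 𝓚` with `𝓚` a labelling of a sub-current with sources `B`;
if not, the left side vanishes since `𝐦 - 𝐧` would be such a sub-current).
[cite: AizenmanDuminilCopinAnnals2021, Lemma 3.3] [cite: DuminilCopin2016, Lemma 2.2 (proof)] -/
theorem switching_comb_subcurrent (m : Current G) (A B : Finset V) :
    ∑ n ∈ Fintype.piFinset (fun e : G.edgeFinset => range (m e + 1)),
        (if sources n = A ∧ sources (m - n) = B then ∏ e, ((m e).choose (n e) : ℝ) else 0) =
      (if ∃ k : Current G, k ≤ m ∧ sources k = B then 1 else 0) *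
        ∑ n ∈ Fintype.piFinset (fun e : G.edgeFinset => range (m e + 1)),
          (if sources n = A ∆ B ∧ sources (m - n) = ∅ then ∏ e, ((m e).choose (n e) : ℝ)
            else 0) := by
  set box := Fintype.piFinset (fun e : G.edgeFinset => range (m e + 1)) with hbox
  by_cases hm : sources m = A ∆ B
  · -- the source constraints on `m - n` are automatic
    have hL : ∀ n ∈ box, (sources n = A ∧ sources (m - n) = B ↔ sources n = A) := by
      intro n hn
      refine ⟨fun h => h.1, fun h => ⟨h, ?_⟩⟩
      rw [sources_tsub G ((mem_box_iff G).1 hn), hm, h, symmDiff_comm A B, symmDiff_assoc,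
        symmDiff_self, symmDiff_bot]
    have hR : ∀ n ∈ box, (sources n = A ∆ B ∧ sources (m - n) = ∅ ↔ sources n = A ∆ B) := by
      intro n hn
      refine ⟨fun h => h.1, fun h => ⟨h, ?_⟩⟩
      rw [sources_tsub G ((mem_box_iff G).1 hn), hm, h, symmDiff_self, Finset.bot_eq_empty]
    rw [Finset.sum_congr rfl fun n hn => if_congr (hL n hn) rfl rfl,
      Finset.sum_congr rfl fun n hn => if_congr (hR n hn) rfl rfl,
      sum_box_ite_sources_eq_card, sum_box_ite_sources_eq_card]
    by_cases hF : ∃ k : Current G, k ≤ m ∧ sources k = B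
    · rw [if_pos hF, one_mul]
      obtain ⟨k, hkm, hk⟩ := hF
      obtain ⟨K, hK⟩ := exists_labelled_of_le G hkm
      have hKs : sources (fun e => (K e).card) = B := by rw [hK]; exact hk
      rw [card_filter_sources_eq_of_symmDiff G K A, hKs]
    · rw [if_neg hF, zero_mul]
      -- no labelled sub-current has sources `A`: otherwise `m - n` would have sources `B`
      rw [Nat.cast_eq_zero, Finset.card_eq_zero, Finset.filter_eq_empty_iff]
      intro T _ hT
      apply hF
      set n : Current G := fun e => (T e).card with hn
      have hnle : n ≤ m := fun e => (Finset.card_le_univ (T e)).trans (by simp)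
      refine ⟨m - n, tsub_le_self' G m n, ?_⟩
      rw [sources_tsub G hnle, hm, hT, symmDiff_comm A B, symmDiff_assoc, symmDiff_self,
        symmDiff_bot]
  · -- `∂m ≠ A ∆ B`: every summand vanishes on both sides
    have hL0 : ∀ n ∈ box, ¬(sources n = A ∧ sources (m - n) = B) := by
      rintro n hn ⟨h1, h2⟩
      apply hm
      rw [sources_tsub G ((mem_box_iff G).1 hn), h1] at h2
      rw [← h2, symmDiff_comm _ A, ← symmDiff_assoc, symmDiff_self, bot_symmDiff]
    have hR0 : ∀ n ∈ box, ¬(sources n = A ∆ B ∧ sources (m - n) = ∅) := by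
      rintro n hn ⟨h1, h2⟩
      apply hm
      rw [sources_tsub G ((mem_box_iff G).1 hn), h1, ← Finset.bot_eq_empty, symmDiff_eq_bot] at h2
      exact h2
    rw [Finset.sum_eq_zero fun n hn => if_neg (hL0 n hn),
      Finset.sum_eq_zero fun n hn => if_neg (hR0 n hn), mul_zero]

end Current

open Classical in
/-- **The switching lemma, `𝓕_B` form** (Aizenman–Duminil-Copin 2021, Lemma 3.3: "For any
`A, B ⊂ Λ` and any function `F` from the set of currents into `ℝ`,
`∑_{∂𝐧₁=A, ∂𝐧₂=B} F(𝐧₁+𝐧₂) w(𝐧₁)w(𝐧₂) = ∑_{∂𝐧₁=A∆B, ∂𝐧₂=∅} F(𝐧₁+𝐧₂) w(𝐧₁)w(𝐧₂) 𝟙_{𝐧₁+𝐧₂ ∈ 𝓕_B}`";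
Griffiths–Hurst–Sherman 1970; Aizenman 1982, Lemma 3.2; Duminil-Copin 2016, Lemma 2.2), on the
finite graph `G`, for bounded `F` (which makes both series absolutely convergent) and every real
`β`. Proof as for `currentSum_switching_holds`: change of variables `(𝐦, 𝐧) = (𝐧₁+𝐧₂, 𝐧₁)`
(`tsum_pair_eq_tsum_sum_box`), `w(𝐧)w(𝐦-𝐧) = w(𝐦)C(𝐦,𝐧)` (`Current.weight_mul_weight_tsub`), and
`Current.switching_comb_subcurrent` for each `𝐦`.
[cite: AizenmanDuminilCopinAnnals2021, Lemma 3.3] [cite: DuminilCopin2016, Lemma 2.2] -/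
theorem currentSum_switching_subcurrent (β : ℝ) (A B : Finset V) (F : Current G → ℝ)
    (hF : ∃ C, ∀ n, ‖F n‖ ≤ C) :
    ∑' p : Current G × Current G, pairWeight G β A B p * F (p.1 + p.2) =
      ∑' p : Current G × Current G,
        pairWeight G β (A ∆ B) ∅ p * F (p.1 + p.2) * (subcurrentEvent G B).indicator 1 p := by
  obtain ⟨C, hC⟩ := hF
  -- summability of both families
  have hsL : Summable fun p : Current G × Current G => pairWeight G β A B p * F (p.1 + p.2) :=
    summable_pairWeight_mul G β A B (Φ := fun p => F (p.1 + p.2)) fun p => hC _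
  have hsR : Summable fun p : Current G × Current G =>
      pairWeight G β (A ∆ B) ∅ p * F (p.1 + p.2) * (subcurrentEvent G B).indicator 1 p := by
    have h := summable_pairWeight_mul G β (A ∆ B) ∅
      (Φ := fun p => F (p.1 + p.2) * (subcurrentEvent G B).indicator 1 p) (C := C) fun p => by
        rw [norm_mul]
        refine le_trans (mul_le_of_le_one_right (norm_nonneg _) ?_) (hC _)
        rw [Set.indicator_apply]
        split_ifs <;> simp
    exact h.congr fun p => by ring
  rw [tsum_pair_eq_tsum_sum_box G hsL, tsum_pair_eq_tsum_sum_box G hsR]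
  refine tsum_congr fun m => ?_
  -- evaluate both inner sums
  have hbox : ∀ n ∈ Fintype.piFinset (fun e : G.edgeFinset => range (m e + 1)), n ≤ m :=
    fun n hn => (Current.mem_box_iff G).1 hn
  have hL : ∀ n ∈ Fintype.piFinset (fun e : G.edgeFinset => range (m e + 1)),
      pairWeight G β A B (n, m - n) * F (n + (m - n)) =
        F m * m.weight β *
          (if Current.sources n = A ∧ Current.sources (m - n) = B then
            ∏ e, ((m e).choose (n e) : ℝ) else 0) := by
    intro n hn
    rw [Current.add_tsub_cancel G (hbox n hn)]
    unfold pairWeight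
    split_ifs <;> (try rw [Current.weight_mul_weight_tsub G (hbox n hn)]) <;> ring
  have hR : ∀ n ∈ Fintype.piFinset (fun e : G.edgeFinset => range (m e + 1)),
      pairWeight G β (A ∆ B) ∅ (n, m - n) * F (n + (m - n)) *
          (subcurrentEvent G B).indicator 1 (n, m - n) =
        F m * m.weight β * ((if ∃ k : Current G, k ≤ m ∧ k.sources = B then 1 else 0) *
          (if Current.sources n = A ∆ B ∧ Current.sources (m - n) = ∅ then
            ∏ e, ((m e).choose (n e) : ℝ) else 0)) := by
    intro n hn
    have hind : (subcurrentEvent G B).indicator (1 : Current G × Current G → ℝ) (n, m - n) =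
        if ∃ k : Current G, k ≤ m ∧ k.sources = B then 1 else 0 := by
      rw [Set.indicator_apply, mem_subcurrentEvent_iff]
      simp only [Current.add_tsub_cancel G (hbox n hn), Pi.one_apply]
    rw [hind, Current.add_tsub_cancel G (hbox n hn)]
    unfold pairWeight
    split_ifs <;> (try rw [Current.weight_mul_weight_tsub G (hbox n hn)]) <;> ring
  rw [Finset.sum_congr rfl hL, Finset.sum_congr rfl hR, ← Finset.mul_sum, ← Finset.mul_sum,
    ← Finset.mul_sum, Current.switching_comb_subcurrent G m A B]

/-- The `𝓕_B` switching lemma with `F = 1`, as an identity of series, for every real `β`: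
`Z_A · Z_B = ∑_{∂n₁ = A ∆ B, ∂n₂ = ∅} w(n₁) w(n₂) 𝟙[n₁ + n₂ ∈ 𝓕_B]`
(Aizenman–Duminil-Copin 2021, Lemma 3.3). [cite: AizenmanDuminilCopinAnnals2021, Lemma 3.3] -/
theorem currentSum_mul_currentSum_eq_tsum_subcurrent (β : ℝ) (A B : Finset V) :
    currentSum G β A * currentSum G β B =
      ∑' p : Current G × Current G,
        pairWeight G β (A ∆ B) ∅ p * (subcurrentEvent G B).indicator 1 p := by
  have hsw := currentSum_switching_subcurrent G β A B (fun _ => 1) ⟨1, fun n => by simp⟩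
  simp only [mul_one] at hsw
  rw [(hasSum_pairWeight_holds G β A B).tsum_eq] at hsw
  exact hsw

/-- The `𝓕_B` switching lemma with `F = 1` in probabilistic form, for `β ≥ 0`:
`Z_A · Z_B = Z_{A∆B} · Z_∅ · P^{A∆B} ⊗ P^∅[n₁ + n₂ ∈ 𝓕_B]` (Aizenman–Duminil-Copin 2021,
Lemma 3.3 and (3.7)); no non-degeneracy hypothesis (both sides vanish when `Z_{A∆B} = 0`).
[cite: AizenmanDuminilCopinAnnals2021, Lemma 3.3] -/
theorem currentSum_mul_currentSum_subcurrent {β : ℝ} (hβ : 0 ≤ β) (A B : Finset V) :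
    currentSum G β A * currentSum G β B =
      currentSum G β (A ∆ B) * currentSum G β ∅ *
        (doubleCurrentMeasure G β (A ∆ B) ∅).real (subcurrentEvent G B) := by
  rw [currentSum_mul_currentSum_eq_tsum_subcurrent G β A B, mul_comm (_ * _),
    doubleCurrentMeasure_real_mul' G hβ (A ∆ B) ∅ (measurableSet_subcurrentEvent G B)]

/-- **Discharge of `isingCorr_mul_eq_doubleCurrent_subcurrent`** — source insertion
(Aizenman–Duminil-Copin 2021, eq. (3.7): "`⟨σ_A⟩_{Λ,β}⟨σ_B⟩_{Λ,β} / ⟨σ_Aσ_B⟩_{Λ,β} =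
P^{A∆B,∅}_{Λ,β}[𝐧₁ + 𝐧₂ ∈ 𝓕_B]`", the first consequence of the switching lemma, Lemma 3.3;
Duminil-Copin 2016, p. 10): for the nearest-neighbour Ising model on the finite graph `G` with
free boundary condition, zero field and `β ≥ 0`, and all `A B ⊆ V`,
`⟨σ_A⟩⟨σ_B⟩ = ⟨σ_{A∆B}⟩ · P^{A∆B} ⊗ P^∅[n₁ + n₂ ∈ 𝓕_B]` (product form). From the random-current
representation `⟨σ_A⟩ = Z_A/Z_∅` (`isingCorr_free_eq_currentSum_div_holds`) and
`currentSum_mul_currentSum_subcurrent`.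
[cite: AizenmanDuminilCopinAnnals2021, eq. (3.7)] [cite: AizenmanDuminilCopinAnnals2021, Lemma 3.3] -/
theorem isingCorr_mul_eq_doubleCurrent_subcurrent_holds :
    isingCorr_mul_eq_doubleCurrent_subcurrent G := by
  intro β hβ A B
  have hZ : currentSum G β ∅ ≠ 0 := (currentSum_empty_pos' G β).ne'
  have hsw := currentSum_mul_currentSum_subcurrent G hβ A B
  rw [isingCorr_free_eq_currentSum_div_holds G β A, isingCorr_free_eq_currentSum_div_holds G β B,
    isingCorr_free_eq_currentSum_div_holds G β (A ∆ B)]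
  rw [div_mul_div_comm, hsw]
  field_simp

/-- (3.7) in its printed ratio form: for `β ≥ 0` and `⟨σ_Aσ_B⟩ ≠ 0`,
`⟨σ_A⟩⟨σ_B⟩ / ⟨σ_Aσ_B⟩ = P^{A∆B,∅}[𝐧₁ + 𝐧₂ ∈ 𝓕_B]` (`σ_Aσ_B = σ_{A∆B}`).
[cite: AizenmanDuminilCopinAnnals2021, eq. (3.7)] -/
theorem isingCorr_mul_div_eq_doubleCurrent_subcurrent {β : ℝ} (hβ : 0 ≤ β) (A B : Finset V)
    (hAB : isingCorr G univ β 0 .free (A ∆ B) ≠ 0) :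
    isingCorr G univ β 0 .free A * isingCorr G univ β 0 .free B /
        isingCorr G univ β 0 .free (A ∆ B) =
      (doubleCurrentMeasure G β (A ∆ B) ∅).real (subcurrentEvent G B) := by
  rw [isingCorr_mul_eq_doubleCurrent_subcurrent_holds G hβ A B, mul_div_cancel_left₀ _ hAB]

/-! ### Consistency with the two-source form: `𝓕_{{x}∆{y}} = {x ⟷ y}` -/

/-- For a pair `B = {x} ∆ {y}` the event `𝓕_B` is the connection event: a pair of currents
admits a sub-current `𝐤 ≤ 𝐧₁ + 𝐧₂` with `∂𝐤 = {x} ∆ {y}` iff `x ⟷ y` in the trace of `𝐧₁ + 𝐧₂`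
(Duminil-Copin 2016, §2.2.2: "if `A = {x,y}`, then `E ∈ 𝔉_A` if and only if `x` and `y` are in
the same connected component of `E`"; so Aizenman–Duminil-Copin 2021, Lemma 3.3 with
`B = {x} ∆ {y}` is the two-source switching lemma `currentSum_switching`). (`→`: in the trace of
`𝐤` the source `x` is connected to another source, `Current.exists_source_reachable`, and
`𝐤̂ ⊆ (𝐧₁+𝐧₂)^`; `←`: one copy of each edge of a simple path, `Current.exists_labelled_sources_pair`.)
[cite: DuminilCopin2016, §2.2.2] [cite: AizenmanDuminilCopinAnnals2021, Def. 3.2] -/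
theorem subcurrentEvent_pair (x y : V) : subcurrentEvent G ({x} ∆ {y}) = tracedConn G x y := by
  classical
  ext p
  rw [mem_subcurrentEvent_iff, mem_tracedConn_iff]
  by_cases hxy : x = y
  · subst hxy
    exact ⟨fun _ => SimpleGraph.Reachable.refl x, fun _ =>
      ⟨0, bot_le, by rw [Current.sources_zero, symmDiff_self, Finset.bot_eq_empty]⟩⟩
  constructor
  · rintro ⟨k, hk, hks⟩
    have hx : x ∈ k.sources := by
      rw [hks, Current.symmDiff_singleton_eq_pair hxy]
      exact Finset.mem_insert_self x {y}
    obtain ⟨y', hy', hy'x, hreach⟩ := Current.exists_source_reachable G k hx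
    rw [hks, Current.symmDiff_singleton_eq_pair hxy, Finset.mem_insert, Finset.mem_singleton]
      at hy'
    rcases hy' with rfl | rfl
    · exact absurd rfl hy'x
    · -- the trace is monotone: `𝐤̂ ⊆ (𝐧₁ + 𝐧₂)^`
      refine hreach.mono (SimpleGraph.fromEdgeSet_mono ?_)
      rintro e ⟨he, hpos⟩
      exact ⟨he, lt_of_lt_of_le hpos (hk ⟨e, he⟩)⟩
  · intro h
    obtain ⟨K, hK⟩ := Current.exists_labelled_sources_pair G hxy h
    refine ⟨fun e => (K e).card, fun e => (Finset.card_le_univ (K e)).trans (by simp), ?_⟩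
    rw [hK, Current.symmDiff_singleton_eq_pair hxy]

/-- Hence the `𝓕_B` identities specialise to the pair identities of `RandomCurrents.lean`: for
`β ≥ 0`, `P^{A∆{x}∆{y},∅}[𝐧₁ + 𝐧₂ ∈ 𝓕_{{x}∆{y}}] = P^{A∆{x}∆{y},∅}[x ⟷ y]`, so that
`currentSum_mul_currentSum_subcurrent` with `B = {x} ∆ {y}` is `currentSum_mul_currentSum_pair`.
[cite: AizenmanDuminilCopinAnnals2021, Lemma 3.3] -/
theorem currentSum_mul_currentSum_subcurrent_pair {β : ℝ} (hβ : 0 ≤ β) (A : Finset V) (x y : V) :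
    currentSum G β A * currentSum G β ({x} ∆ {y}) =
      currentSum G β (A ∆ ({x} ∆ {y})) * currentSum G β ∅ *
        (doubleCurrentMeasure G β (A ∆ ({x} ∆ {y})) ∅).real (tracedConn G x y) := by
  rw [← subcurrentEvent_pair G x y]
  exact currentSum_mul_currentSum_subcurrent G hβ A ({x} ∆ {y})

end Literature.Probability.LatticeModels
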